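import Literature.NumberTheory.EllipticCurves.ModularCurve
import Literature.NumberTheory.EllipticCurves.RealLatticePeriod
import Literature.NumberTheory.EllipticCurves.Uniformization
import HarnessLib

/-!
# Half-lattice bookkeeping and the Vélu model of a rational `2`-torsion point (tools for the Γ₀/Γ₁ ledger's Néron bit)

Summit `BirchSwinnertonDyer`, route `ManinLocalTwoThree` (cell bsd-f2-manin), deciding crux C2 `ManinOddAtFour`
(stmt-BirchSwinnertonDyer-22967); helpers for the an planner's E-an-66 «totally blind Γ₁-transfer» (`ShimuraLedger.lean`).
Elementary facts, no definitions:

* (the invariants depend only on the lattice: tree `PeriodPair.g₂_eq_of_lattice_eq` / `g₃_eq_of_lattice_eq`,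
  `Uniformization.lean`);
* `halfLattice_trichotomy` — for period lattices `Λ ⊆ Λ' ⊆ ½Λ`: `Λ' = Λ`, or `Λ' = ½Λ`, or `Λ'` has index
  `2` over `Λ` with an explicit half-period `z₀` (`Λ' = Λ ⊔ (z₀ + Λ)`) — the three subgroups-of-`(ℤ/2)²` cases, by the
  parities of the coordinates of `2w` in the basis `ω₁, ω₂`;
* `isRoot_cubic_of_weierstrassP_sub` — for a model `y² = x³ + a₂x² + a₄x + a₆` with Néron-type period pair `L`
  (`g₂ = c₄/12`, `g₃ = c₆/216`) and `x₀` a root of `4x³ − g₂x − g₃`, the number `e = x₀ − a₂/3` is a root of the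
  `2`-division cubic `x³ + a₂x² + a₄x + a₆`;
* `Δ_eq_of_isRoot`, `velu_c₄_div`, `velu_c₆_div`, `velu_isElliptic` — with `A = a₂ + 3e`, `B = 3e² + 2a₂e + a₄`:
  `Δ = 16B²(A² − 4B)`, and Vélu's model `V = [0, −2A, 0, A² − 4B, 0]` of the quotient by `(e, 0)` has
  `c₄(V)/12 = 12x₀² + 16B`, `c₆(V)/216 = −8x₀³ + 32Bx₀` (`x₀ = e + a₂/3`) and is elliptic (Silverman *AEC* III.4.5).

Nothing about BSD or the Manin constant is asserted here.
-/

set_option autoImplicit false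
-- the summit-side namespace `Summit.BirchSwinnertonDyer.BirchSwinnertonDyer.…` is the tree's (summit = sub-problem)
set_option linter.dupNamespace false

noncomputable section

open WeierstrassCurve Literature.NumberTheory.EllipticCurves.ModularForms

namespace Summit.BirchSwinnertonDyer.BirchSwinnertonDyer.Theorems.ManinLocalTwoThree

/-! ### Half-lattice trichotomy -/

/-- Every `w` with `2w ∈ Λ` is congruent mod `Λ` to `0`, `ω₁/2`, `ω₂/2` or `(ω₁ + ω₂)/2`. -/
theorem mem_or_sub_half_mem (L : PeriodPair) {w : ℂ} (h2 : 2 * w ∈ L.lattice) :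
    w ∈ L.lattice ∨ w - L.ω₁ / 2 ∈ L.lattice ∨ w - L.ω₂ / 2 ∈ L.lattice ∨ w - (L.ω₁ + L.ω₂) / 2 ∈ L.lattice := by
  obtain ⟨m, n, hmn⟩ := PeriodPair.mem_lattice.mp h2
  have hw : w = (m : ℂ) / 2 * L.ω₁ + (n : ℂ) / 2 * L.ω₂ := by linear_combination -hmn / 2
  rcases Int.even_or_odd m with ⟨m', hm⟩ | ⟨m', hm⟩ <;> rcases Int.even_or_odd n with ⟨n', hn⟩ | ⟨n', hn⟩
  · left
    refine PeriodPair.mem_lattice.mpr ⟨m', n', ?_⟩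
    rw [hw, hm, hn]; push_cast; ring
  · right; right; left
    refine PeriodPair.mem_lattice.mpr ⟨m', n', ?_⟩
    rw [hw, hm, hn]; push_cast; ring
  · right; left
    refine PeriodPair.mem_lattice.mpr ⟨m', n', ?_⟩
    rw [hw, hm, hn]; push_cast; ring
  · right; right; right
    refine PeriodPair.mem_lattice.mpr ⟨m', n', ?_⟩
    rw [hw, hm, hn]; push_cast; ring

/-- The non-trivial half-periods: `αω₁ + βω₂ ∉ Λ` for `(α, β) ∈ {(½,0),(0,½),(½,½),(½,−½),(−½,½)}` etc. — packaged as the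
six non-memberships used below. -/
theorem half_notMem (L : PeriodPair) :
    L.ω₁ / 2 ∉ L.lattice ∧ L.ω₂ / 2 ∉ L.lattice ∧ (L.ω₁ + L.ω₂) / 2 ∉ L.lattice ∧
      L.ω₁ / 2 - L.ω₂ / 2 ∉ L.lattice ∧ L.ω₁ / 2 - (L.ω₁ + L.ω₂) / 2 ∉ L.lattice ∧
      L.ω₂ / 2 - (L.ω₁ + L.ω₂) / 2 ∉ L.lattice := by
  have key : ∀ α β : ℚ, ¬ (α.den = 1 ∧ β.den = 1) → (α : ℂ) * L.ω₁ + (β : ℂ) * L.ω₂ ∉ L.lattice :=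
    fun α β h hmem ↦ h (PeriodPair.mul_ω₁_add_mul_ω₂_mem_lattice.mp hmem)
  refine ⟨?_, ?_, ?_, ?_, ?_, ?_⟩
  · have h := key (1 / 2) 0 (by norm_num); intro hm; apply h; convert hm using 1; push_cast; ring
  · have h := key 0 (1 / 2) (by norm_num); intro hm; apply h; convert hm using 1; push_cast; ring
  · have h := key (1 / 2) (1 / 2) (by norm_num); intro hm; apply h; convert hm using 1; push_cast; ring
  · have h := key (1 / 2) (-(1 / 2)) (by norm_num); intro hm; apply h; convert hm using 1; push_cast; ring
  · have h := key 0 (-(1 / 2)) (by norm_num); intro hm; apply h; convert hm using 1; push_cast; ring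
  · have h := key (-(1 / 2)) 0 (by norm_num); intro hm; apply h; convert hm using 1; push_cast; ring

/-- **Half-lattice trichotomy.**  Let `Λ ⊆ Λ'` be period lattices with `2Λ' ⊆ Λ`.  Then `Λ' = Λ`, or `Λ' ⊇ ½Λ` (every
`h` with `2h ∈ Λ` lies in `Λ'`), or `Λ'` has index `2` over `Λ`: some `z₀ ∈ Λ' ∖ Λ` with `Λ' ⊆ Λ ∪ (z₀ + Λ)`.  (The three
kinds of subgroups of `½Λ/Λ ≅ (ℤ/2)²`.) -/
theorem halfLattice_trichotomy (L L' : PeriodPair) (hle : L.lattice ≤ L'.lattice)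
    (h2 : ∀ w ∈ L'.lattice, 2 * w ∈ L.lattice) :
    (∀ w ∈ L'.lattice, w ∈ L.lattice) ∨ (∀ h : ℂ, 2 * h ∈ L.lattice → h ∈ L'.lattice) ∨
      ∃ z₀ ∈ L'.lattice, z₀ ∉ L.lattice ∧ ∀ w ∈ L'.lattice, w ∈ L.lattice ∨ w - z₀ ∈ L.lattice := by
  obtain ⟨n1, n2, n3, n12, n13, n23⟩ := half_notMem L
  set h₁ := L.ω₁ / 2 with hh₁
  set h₂ := L.ω₂ / 2 with hh₂
  set h₃ := (L.ω₁ + L.ω₂) / 2 with hh₃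
  have e3 : h₃ = h₁ + h₂ := by rw [hh₁, hh₂, hh₃]; ring
  -- closing a pair of half-periods under the group law
  have close : ∀ {a b : ℂ}, a ∈ L'.lattice → b - a ∈ L.lattice → b ∈ L'.lattice := by
    intro a b ha hba
    have : b = (b - a) + a := by ring
    rw [this]; exact add_mem (hle hba) ha
  -- if some `w ∈ Λ'` is `≡ hᵢ`, then `hᵢ ∈ Λ'`
  have back : ∀ {w a : ℂ}, w ∈ L'.lattice → w - a ∈ L.lattice → a ∈ L'.lattice := by
    intro w a hw hwa
    have : a = w - (w - a) := by ring
    rw [this]; exact sub_mem hw (hle hwa)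
  by_cases b1 : h₁ ∈ L'.lattice <;> by_cases b2 : h₂ ∈ L'.lattice <;> by_cases b3 : h₃ ∈ L'.lattice
  -- all three in: case 2
  · right; left
    intro h hh
    rcases mem_or_sub_half_mem L hh with h0 | h0 | h0 | h0
    · exact hle h0
    · exact close b1 h0
    · exact close b2 h0
    · exact close b3 h0
  · exact absurd (e3 ▸ add_mem b1 b2) b3
  · exfalso; apply b2
    have : h₂ = h₃ - h₁ := by rw [e3]; ring
    rw [this]; exact sub_mem b3 b1
  -- exactly `h₁`: case 3
  · right; right
    refine ⟨h₁, b1, n1, fun w hw ↦ ?_⟩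
    rcases mem_or_sub_half_mem L (h2 w hw) with h0 | h0 | h0 | h0
    · exact Or.inl h0
    · exact Or.inr h0
    · exact absurd (back hw h0) b2
    · exact absurd (back hw h0) b3
  · exfalso; apply b1
    have : h₁ = h₃ - h₂ := by rw [e3]; ring
    rw [this]; exact sub_mem b3 b2
  -- exactly `h₂`
  · right; right
    refine ⟨h₂, b2, n2, fun w hw ↦ ?_⟩
    rcases mem_or_sub_half_mem L (h2 w hw) with h0 | h0 | h0 | h0
    · exact Or.inl h0
    · exact absurd (back hw h0) b1
    · exact Or.inr h0
    · exact absurd (back hw h0) b3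
  -- exactly `h₃`
  · right; right
    refine ⟨h₃, b3, n3, fun w hw ↦ ?_⟩
    rcases mem_or_sub_half_mem L (h2 w hw) with h0 | h0 | h0 | h0
    · exact Or.inl h0
    · exact absurd (back hw h0) b1
    · exact absurd (back hw h0) b2
    · exact Or.inr h0
  -- none: case 1
  · left
    intro w hw
    rcases mem_or_sub_half_mem L (h2 w hw) with h0 | h0 | h0 | h0
    · exact h0
    · exact absurd (back hw h0) b1
    · exact absurd (back hw h0) b2
    · exact absurd (back hw h0) b3

/-! ### The `2`-division cubic and Vélu's model for `y² = x³ + a₂x² + a₄x + a₆` -/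

/-- For a model with `a₁ = a₃ = 0`: `4(x₀)³ − (c₄/12)x₀ − c₆/216 = 4(e³ + a₂e² + a₄e + a₆)` with `e = x₀ − a₂/3` (the
shift `x = X − b₂/12` between `y² = 4x³ − g₂x − g₃` and the model). Over any field of characteristic `0`. -/
theorem cubic_shift_identity {K : Type*} [Field K] [CharZero K] (W : WeierstrassCurve K) (ha₁ : W.a₁ = 0)
    (ha₃ : W.a₃ = 0) (x₀ : K) :
    4 * x₀ ^ 3 - W.c₄ / 12 * x₀ - W.c₆ / 216 =
      4 * ((x₀ - W.a₂ / 3) ^ 3 + W.a₂ * (x₀ - W.a₂ / 3) ^ 2 + W.a₄ * (x₀ - W.a₂ / 3) + W.a₆) := by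
  simp only [WeierstrassCurve.c₄, WeierstrassCurve.c₆, WeierstrassCurve.b₂, WeierstrassCurve.b₄, WeierstrassCurve.b₆, ha₁,
    ha₃]
  ring

/-- **The half-period abscissa is a root of the `2`-division cubic.**  For `W/ℚ` with `a₁ = a₃ = 0` and a Néron-type period
pair `L` (`g₂ = c₄/12`, `g₃ = c₆/216`), if `x₀ ∈ ℂ` satisfies `4x₀³ − g₂x₀ − g₃ = 0` then `e = x₀ − a₂/3` satisfies
`e³ + a₂e² + a₄e + a₆ = 0` (over `ℂ`). -/
theorem isRoot_cubic_of_weierstrassP_sub (W : WeierstrassCurve ℚ) (ha₁ : W.a₁ = 0) (ha₃ : W.a₃ = 0) {L : PeriodPair}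
    (hL : IsNeronLatticeOf (W.baseChange ℂ) L) {x₀ : ℂ} (hx₀ : 4 * x₀ ^ 3 - L.g₂ * x₀ - L.g₃ = 0) :
    (x₀ - (W.a₂ : ℂ) / 3) ^ 3 + (W.a₂ : ℂ) * (x₀ - (W.a₂ : ℂ) / 3) ^ 2 + (W.a₄ : ℂ) * (x₀ - (W.a₂ : ℂ) / 3) +
      (W.a₆ : ℂ) = 0 := by
  have h := cubic_shift_identity (W.baseChange ℂ) (by simp [WeierstrassCurve.baseChange, ha₁])
    (by simp [WeierstrassCurve.baseChange, ha₃]) x₀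
  rw [← hL.1, ← hL.2, hx₀] at h
  have h' : ((x₀ - (W.baseChange ℂ).a₂ / 3) ^ 3 + (W.baseChange ℂ).a₂ * (x₀ - (W.baseChange ℂ).a₂ / 3) ^ 2 +
      (W.baseChange ℂ).a₄ * (x₀ - (W.baseChange ℂ).a₂ / 3) + (W.baseChange ℂ).a₆) = 0 := by
    linear_combination -h / 4
  simpa [WeierstrassCurve.baseChange] using h'

/-- **`B = 3x₀² − g₂/4`** in curve terms: for `a₁ = a₃ = 0`, `g₂ = c₄/12` and `x₀ = e + a₂/3`,
`3x₀² − g₂/4 = 3e² + 2a₂e + a₄`. -/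
theorem velu_B_identity {K : Type*} [Field K] [CharZero K] (W : WeierstrassCurve K) (ha₁ : W.a₁ = 0)
    (ha₃ : W.a₃ = 0) (e : K) :
    3 * (e + W.a₂ / 3) ^ 2 - W.c₄ / 12 / 4 = 3 * e ^ 2 + 2 * W.a₂ * e + W.a₄ := by
  simp only [WeierstrassCurve.c₄, WeierstrassCurve.b₂, WeierstrassCurve.b₄, ha₁, ha₃]
  ring

/-- **`Δ = 16B²(A² − 4B)`** for `y² = x³ + a₂x² + a₄x + a₆` with a root `e` of the cubic, `A = a₂ + 3e`,
`B = 3e² + 2a₂e + a₄` (translate `x ↦ x + e`: the model becomes `y² = x(x² + Ax + B)`). -/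
theorem Δ_eq_of_isRoot {K : Type*} [Field K] (W : WeierstrassCurve K) (ha₁ : W.a₁ = 0) (ha₃ : W.a₃ = 0) {e : K}
    (he : e ^ 3 + W.a₂ * e ^ 2 + W.a₄ * e + W.a₆ = 0) :
    W.Δ = 16 * (3 * e ^ 2 + 2 * W.a₂ * e + W.a₄) ^ 2 * ((W.a₂ + 3 * e) ^ 2 - 4 * (3 * e ^ 2 + 2 * W.a₂ * e + W.a₄)) := by
  have ha₆ : W.a₆ = -(e ^ 3 + W.a₂ * e ^ 2 + W.a₄ * e) := by linear_combination he
  simp only [WeierstrassCurve.Δ, WeierstrassCurve.b₂, WeierstrassCurve.b₄, WeierstrassCurve.b₆, WeierstrassCurve.b₈, ha₁,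
    ha₃, ha₆]
  ring

/-- **Vélu's invariants**: for `V = [0, −2A, 0, A² − 4B, 0]` with `A = 3x₀`: `c₄(V)/12 = 12x₀² + 16B`. -/
theorem velu_c₄_div {K : Type*} [Field K] [CharZero K] (x₀ B : K) :
    (⟨0, -2 * (3 * x₀), 0, (3 * x₀) ^ 2 - 4 * B, 0⟩ : WeierstrassCurve K).c₄ / 12 = 12 * x₀ ^ 2 + 16 * B := by
  simp only [WeierstrassCurve.c₄, WeierstrassCurve.b₂, WeierstrassCurve.b₄]
  ring

/-- **Vélu's invariants**: for `V = [0, −2A, 0, A² − 4B, 0]` with `A = 3x₀`: `c₆(V)/216 = −8x₀³ + 32Bx₀`. -/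
theorem velu_c₆_div {K : Type*} [Field K] [CharZero K] (x₀ B : K) :
    (⟨0, -2 * (3 * x₀), 0, (3 * x₀) ^ 2 - 4 * B, 0⟩ : WeierstrassCurve K).c₆ / 216 = -8 * x₀ ^ 3 + 32 * B * x₀ := by
  simp only [WeierstrassCurve.c₆, WeierstrassCurve.b₂, WeierstrassCurve.b₄, WeierstrassCurve.b₆]
  ring

/-- **Vélu's model is elliptic**: `Δ(V) = 256 B (A² − 4B)²` is non-zero when `B ≠ 0` and `A² − 4B ≠ 0`. -/
theorem velu_Δ {K : Type*} [Field K] (A B : K) :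
    (⟨0, -2 * A, 0, A ^ 2 - 4 * B, 0⟩ : WeierstrassCurve K).Δ = 256 * B * (A ^ 2 - 4 * B) ^ 2 := by
  simp only [WeierstrassCurve.Δ, WeierstrassCurve.b₂, WeierstrassCurve.b₄, WeierstrassCurve.b₆, WeierstrassCurve.b₈]
  ring

/-- Vélu's model is an elliptic curve when `B ≠ 0` and `A² − 4B ≠ 0`. -/
theorem velu_isElliptic {K : Type*} [Field K] [CharZero K] {A B : K} (hB : B ≠ 0) (hAB : A ^ 2 - 4 * B ≠ 0) :
    (⟨0, -2 * A, 0, A ^ 2 - 4 * B, 0⟩ : WeierstrassCurve K).IsElliptic := by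
  refine ⟨isUnit_iff_ne_zero.mpr ?_⟩
  rw [velu_Δ]
  exact mul_ne_zero (mul_ne_zero (by norm_num) hB) (pow_ne_zero 2 hAB)

end Summit.BirchSwinnertonDyer.BirchSwinnertonDyer.Theorems.ManinLocalTwoThree

end
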